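import Summits.QuantumFields.YangMills.Theorems.BalabanUVNodesN19LinkReadingAtU3Pin

/-!
# BalabanUVNodes ∕ N19 — NODE U3's UNIFORM-LETTERS CLAUSE `hunif` AT THE (t-U3) PIN IS THE LETTER ROW `0 < ρ < 1`:
# the pinned bundle's `ρ ∕ cr ∕ C₉ ∕ ω` ARE the letter block's (`rfl`), uniformly in `(hP, g₀, os, k)`

Cell `pub-ymgap`, HUMAN RULING D-0062 (Track A) ∕ D-0149 ∕ D-0154 (director-ym R399 (3a), №207 width wave), width seat `pub-ymgap-dag-n19-w5`
(harness re-seat g1 of generation 0), FILE 5.  THEOREMS ONLY (0 `def`, 0 `instance`, 0 `sorry`); imports this seat's FILE 2 `BalabanUVNodesN19LinkReadingAtU3Pin`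
ONLY; modifies nothing; `--kind proof --supports` K3⁷ `SpineGivenEndpointR13SepCoPH` (stmt-QuantumFields-20544) `--as helper` — COUNT-NEUTRAL.

WHY.  Every N19′-face ∕ item-level composite in the tree carries, next to K3⁷ v5's key, the UNIFORM-LETTERS clause on node U3's objects of the reading
`hunif : ∀ F θ hP, G θ → θ.Admissible F N → ∃ M ρ₁ : ℝ, 0 ≤ M ∧ ρ₁ < 1 ∧ ∀ g₀ os k, 0 < R.u3.ρ ∧ R.u3.ρ ≤ ρ₁ ∧ R.u3.cr * R.u3.C₉ * R.u3.ω ≤ M`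
(`R := rateCarriersOfRecord₁₃CoPH 𝔯 F θ hP g₀ os k`): dag-n19-w3's `…N19RateEdgeHolderD4AtTuningWindow(V)`, `…AtN16PinnedReading(V)FSC`, `…N19KeyedCoreEdgeHolderD4K3V5`,
dag-n27's `…N27AtAllPinsOfRecord13CoPHVCutLinkReading` and the ITEM-LEVEL conditional `…N27SpineGivenEndpointR13SepCoPHAllPinsOfRecordVLinkReading` — as a
HYPOTHESIS supplied by nobody.  Under v5's (t-U3) pin `U3PinnedKernels 𝔯 ℓ` (per tuple: `(𝔯.lit F θ hP g₀ os).u3 = objectsOfRecord₁₃ F N θ (ℓ F θ)`) the reading's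
node-U3 bundle is `u3OfRecord₁₃ θ (objectsOfRecord₁₃ F N θ (ℓ F θ)) k` (FILE 2 `u3_rateCarriersOfRecord₁₃CoPH_of_pin`), whose letters `ρ, cr, C₉, ω` (like `κ`, FILE 2
`kappa_eq_letter`) ARE the letter block's `(ℓ F θ).ρ, .cr, .C₉, .ω` by `rfl` (def-W1's `U3Objects₁₁.ofFixed` keeps `ℓ`; `u3OfRecord₁₃` :74–75 copies the fields) — they do
not read `(hP, g₀, os, k)` at all.  Hence AT THE PIN `hunif` ⟺ the LETTER ROW `0 < (ℓ F θ).ρ ∧ (ℓ F θ).ρ < 1` per guarded admissible tuple (`ρ₁ := ρ`,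
`M := max 0 (cr·C₉·ω)`); and that row FOLLOWS from the DISPLAYED LETTER SIGNS `(ℓ F θ).Signs` (`0 < θ₅ ≤ ρ < 1`, def-W1∕n27-w1's `U3Letters₁₁.Signs`), which stub 1's
bill already carries as `hs` (dag-n27-w1 `K3V5Defs.keyedRatesHolderD4_rrOfRecord_of_pins_of_letters`, next to `hρ : 0 ≤ ρ ∧ ρ < 1`) — so under the pin `hunif` costs NOTHING beyond
stub 1's bill and can leave every composite's signature (`hunif_of_u3Pinned_of_signs`).
* §1 at the pinned bundle [folklore, `rfl`]: `rho_eq_letter`, `cr_eq_letter`, `C9_eq_letter`, `omega_eq_letter`, `theta5_eq_letter`, `C5_eq_letter`.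
* §2 [bookkeeping]: `rho_row_of_signs` (`ℓ.Signs → 0 < ℓ.ρ ∧ ℓ.ρ < 1`); `uniformLetters_atPin_iff` — the `∃ M ρ₁ …` body over the `(g₀, os, k)`-indexed family of pinned
  bundles (any indexing type) ⟺ `0 < ℓ.ρ ∧ ℓ.ρ < 1` (given one index, to read `ρ₁ < 1` back); `uniformLetters_atPin_of_rho` (⟸, no inhabitation needed).
* §3 under the pin equation at the reading [bookkeeping]: ★ `hunif_of_u3Pinned_of_rho` — the consumers' VERBATIM `hunif` text (generic `N`, guard `G`) from the per-tuple pin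
  and the row `∀ F θ hP, G θ → θ.Admissible F N → 0 < (ℓ F θ).ρ ∧ (ℓ F θ).ρ < 1`; ★★ `hunif_of_u3Pinned_of_signs` (from the pin and stub 1's bill row `hs` ALONE);
  `rho_row_of_hunif_of_u3Pinned` (converse); ★ `hunif_iff_rho_row_of_u3Pinned`.

LOCATED (count-neutral; for the plan's v6 precut letter list and the composites' next editions).  Node U3's uniform-letters clause is NOT an input at v5's key: under
the (t-U3) pin it is IMPLIED by the displayed letter signs `(ℓ F θ).Signs` of stub 1's bill (`0 < θ₅ ≤ ρ < 1`); a composite keyed on the pin + `hs` may drop `hunif`.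

HONEST FRAMING.  `rfl` faces and `max` bookkeeping over HYPOTHESIS shapes; ZERO estimate content; nothing of Bałaban's asserted; no stub closed; N19 NOT discharged; K3⁷ OPEN,
skeleton v5 UNTOUCHED; counts UNMOVED (typed 28∕28 · discharged 5∕27 · A 5∕28).  One finite 𝕋⁴ at fixed ε — R4 closes the CONDITIONAL rung `BalabanLadder.UV` only; the
Yang–Mills mass gap (Clay) is NOT proved by any of this.  [folklore] ∕ [bookkeeping] throughout.
-/

noncomputable section

namespace Summit.QuantumFields.YangMills.BalabanUVNodes.N19UniformLettersAtU3Pin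

open Literature.MathematicalPhysics.QuantumFieldTheory.Balaban1983to89
open Literature.MathematicalPhysics.QuantumFieldTheory.Balaban1983to89.T4Continuum (T4Family ULoop)
open Literature.MathematicalPhysics.QuantumFieldTheory.Balaban1983to89.Node00 (Stage13Params Stage13HParams U3Letters₁₁)
open Literature.MathematicalPhysics.QuantumFieldTheory.Balaban1983to89.Node00.U3OfKernels (objectsOfRecord₁₃)
open YMDAG.UVSplit (RateReading₁₃CoPH u3OfRecord₁₃ rateCarriersOfRecord₁₃CoPH)
open Summit.QuantumFields.YangMills.BalabanUVNodes.N19LinkReadingAtU3Pin (u3_rateCarriersOfRecord₁₃CoPH_of_pin)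

variable {N : ℕ} [NeZero N]

/-! ## §1 The pinned bundle's letters are the letter block's -/

section Letters

variable {F : T4Family} (θ : Stage13Params F N) (ℓ : U3Letters₁₁) (k : ℕ)

/-- **THE JOINT RATE OF THE PINNED BUNDLE IS THE LETTER BLOCK's `ρ`** (`rfl`), uniform in the run length. [folklore] -/
theorem rho_eq_letter : (u3OfRecord₁₃ θ (objectsOfRecord₁₃ F N θ ℓ) k).ρ = ℓ.ρ := rfl

/-- The read-out domination constant of the pinned bundle is the letter block's `cr` (`rfl`). [folklore] -/
theorem cr_eq_letter : (u3OfRecord₁₃ θ (objectsOfRecord₁₃ F N θ ℓ) k).cr = ℓ.cr := rfl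

/-- The fading-memory constant of the pinned bundle is the letter block's `C₉` (`rfl`). [folklore] -/
theorem C9_eq_letter : (u3OfRecord₁₃ θ (objectsOfRecord₁₃ F N θ ℓ) k).C₉ = ℓ.C₉ := rfl

/-- The fading-memory rate of the pinned bundle is the letter block's `ω` (`rfl`). [folklore] -/
theorem omega_eq_letter : (u3OfRecord₁₃ θ (objectsOfRecord₁₃ F N θ ℓ) k).ω = ℓ.ω := rfl

/-- The NE5 rate of the pinned bundle is the letter block's `θ₅` (`rfl`). [folklore] -/
theorem theta5_eq_letter : (u3OfRecord₁₃ θ (objectsOfRecord₁₃ F N θ ℓ) k).θ = ℓ.θ₅ := rfl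

/-- The NE5 constant of the pinned bundle is the letter block's `C₅` (`rfl`). [folklore] -/
theorem C5_eq_letter : (u3OfRecord₁₃ θ (objectsOfRecord₁₃ F N θ ℓ) k).C₅ = ℓ.C₅ := rfl

end Letters

/-! ## §2 The uniform-letters body at the pinned bundles ⟺ the row `0 < ρ < 1` -/

section Body

variable {F : T4Family} (θ : Stage13Params F N) (ℓ : U3Letters₁₁)

/-- **THE ROW `0 < ρ < 1` FROM THE DISPLAYED LETTER SIGNS** (`0 < θ₅ ≤ ρ < 1` in `U3Letters₁₁.Signs`). [folklore] -/
theorem rho_row_of_signs {ℓ : U3Letters₁₁} (hs : ℓ.Signs) : 0 < ℓ.ρ ∧ ℓ.ρ < 1 := ⟨lt_of_lt_of_le hs.θ₅_pos hs.θ₅_le_ρ, hs.ρ_lt_one⟩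

/-- **THE UNIFORM-LETTERS BODY FROM THE ROW** [bookkeeping]: over ANY index family `κ i` of run lengths (the consumers index by `(g₀, os, k)`), `0 < ℓ.ρ < 1` gives
`∃ M ρ₁, 0 ≤ M ∧ ρ₁ < 1 ∧ ∀ i, 0 < ρᵢ ∧ ρᵢ ≤ ρ₁ ∧ crᵢ·C₉ᵢ·ωᵢ ≤ M` for the pinned bundles, with `ρ₁ := ℓ.ρ`, `M := max 0 (ℓ.cr·ℓ.C₉·ℓ.ω)`. [folklore] -/
theorem uniformLetters_atPin_of_rho {ι : Sort*} (κ : ι → ℕ) (hρ : 0 < ℓ.ρ ∧ ℓ.ρ < 1) :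
    ∃ M ρ₁ : ℝ, 0 ≤ M ∧ ρ₁ < 1 ∧ ∀ i : ι,
      0 < (u3OfRecord₁₃ θ (objectsOfRecord₁₃ F N θ ℓ) (κ i)).ρ ∧ (u3OfRecord₁₃ θ (objectsOfRecord₁₃ F N θ ℓ) (κ i)).ρ ≤ ρ₁ ∧
        (u3OfRecord₁₃ θ (objectsOfRecord₁₃ F N θ ℓ) (κ i)).cr * (u3OfRecord₁₃ θ (objectsOfRecord₁₃ F N θ ℓ) (κ i)).C₉ *
          (u3OfRecord₁₃ θ (objectsOfRecord₁₃ F N θ ℓ) (κ i)).ω ≤ M :=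
  ⟨max 0 (ℓ.cr * ℓ.C₉ * ℓ.ω), ℓ.ρ, le_max_left _ _, hρ.2, fun _ => ⟨hρ.1, le_rfl, le_max_right _ _⟩⟩

/-- **AT THE PINNED BUNDLES THE UNIFORM-LETTERS BODY ⟺ THE ROW `0 < ρ < 1`** [bookkeeping] (⟹ reads the body at one index `i₀`). [folklore] -/
theorem uniformLetters_atPin_iff {ι : Sort*} (κ : ι → ℕ) (i₀ : ι) :
    (∃ M ρ₁ : ℝ, 0 ≤ M ∧ ρ₁ < 1 ∧ ∀ i : ι,
      0 < (u3OfRecord₁₃ θ (objectsOfRecord₁₃ F N θ ℓ) (κ i)).ρ ∧ (u3OfRecord₁₃ θ (objectsOfRecord₁₃ F N θ ℓ) (κ i)).ρ ≤ ρ₁ ∧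
        (u3OfRecord₁₃ θ (objectsOfRecord₁₃ F N θ ℓ) (κ i)).cr * (u3OfRecord₁₃ θ (objectsOfRecord₁₃ F N θ ℓ) (κ i)).C₉ *
          (u3OfRecord₁₃ θ (objectsOfRecord₁₃ F N θ ℓ) (κ i)).ω ≤ M) ↔
      (0 < ℓ.ρ ∧ ℓ.ρ < 1) := by
  refine ⟨fun ⟨_, ρ₁, _, hρ₁, h⟩ => ?_, uniformLetters_atPin_of_rho θ ℓ κ⟩
  have h0 := h i₀
  exact ⟨h0.1, lt_of_le_of_lt h0.2.1 hρ₁⟩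

end Body

/-! ## §3 Under the pin equation, at the reading: the consumers' `hunif` text -/

section Pinned

variable (𝔯 : RateReading₁₃CoPH N) (G : ∀ {F : T4Family}, Stage13HParams F N → Prop) (ℓ : (F : T4Family) → Stage13HParams F N → U3Letters₁₁)
  (hpin : ∀ (F : T4Family) (θ : Stage13HParams F N) (hP : θ.Provisos₁₃CoPH F N) (g₀ : ℕ → ℝ) (os : List (ULoop F)),
    (𝔯.lit F θ hP g₀ os).u3 = objectsOfRecord₁₃ F N θ.toStage13Params (ℓ F θ))

include hpin

/-- ★ **THE CONSUMERS' `hunif` FROM THE (t-U3) PIN AND THE ROW `0 < ρ < 1`** [bookkeeping]: under the per-tuple pin equation (v5's `U3PinnedKernels 𝔯 ℓ` unfolded), the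
uniform-letters clause of the N19′ composites (VERBATIM text, generic `N`, any guard `G`) follows from `∀ F θ hP, G θ → θ.Admissible F N → 0 < (ℓ F θ).ρ ∧ (ℓ F θ).ρ < 1`. [folklore] -/
theorem hunif_of_u3Pinned_of_rho
    (hρ : ∀ (F : T4Family) (θ : Stage13HParams F N), θ.Provisos₁₃CoPH F N → G θ → θ.Admissible F N → 0 < (ℓ F θ).ρ ∧ (ℓ F θ).ρ < 1) :
    ∀ (F : T4Family) (θ : Stage13HParams F N) (hP : θ.Provisos₁₃CoPH F N), G θ → θ.Admissible F N →
      ∃ M ρ₁ : ℝ, 0 ≤ M ∧ ρ₁ < 1 ∧ ∀ (g₀ : ℕ → ℝ) (os : List (ULoop F)) (k : ℕ), 0 < (rateCarriersOfRecord₁₃CoPH 𝔯 F θ hP g₀ os k).u3.ρ ∧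
        (rateCarriersOfRecord₁₃CoPH 𝔯 F θ hP g₀ os k).u3.ρ ≤ ρ₁ ∧
        (rateCarriersOfRecord₁₃CoPH 𝔯 F θ hP g₀ os k).u3.cr * (rateCarriersOfRecord₁₃CoPH 𝔯 F θ hP g₀ os k).u3.C₉ *
          (rateCarriersOfRecord₁₃CoPH 𝔯 F θ hP g₀ os k).u3.ω ≤ M := by
  intro F θ hP hG hθ
  obtain ⟨h0, h1⟩ := hρ F θ hP hG hθ
  refine ⟨max 0 ((ℓ F θ).cr * (ℓ F θ).C₉ * (ℓ F θ).ω), (ℓ F θ).ρ, le_max_left _ _, h1, fun g₀ os k => ?_⟩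
  rw [u3_rateCarriersOfRecord₁₃CoPH_of_pin 𝔯 θ hP g₀ os (ℓ F θ) (hpin F θ hP g₀ os) k]
  exact ⟨h0, le_rfl, le_max_right _ _⟩

/-- ★★ **THE CONSUMERS' `hunif` FROM THE (t-U3) PIN AND STUB 1's BILL ROW `hs` ALONE** [bookkeeping]: the displayed letter signs `(ℓ F θ).Signs` at every guarded admissible tuple
(dag-n27-w1's `hs`) already give `0 < ρ < 1`; so under the pin the uniform-letters clause is no extra input. [folklore] -/
theorem hunif_of_u3Pinned_of_signs
    (hs : ∀ (F : T4Family) (θ : Stage13HParams F N), θ.Provisos₁₃CoPH F N → G θ → θ.Admissible F N → (ℓ F θ).Signs) :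
    ∀ (F : T4Family) (θ : Stage13HParams F N) (hP : θ.Provisos₁₃CoPH F N), G θ → θ.Admissible F N →
      ∃ M ρ₁ : ℝ, 0 ≤ M ∧ ρ₁ < 1 ∧ ∀ (g₀ : ℕ → ℝ) (os : List (ULoop F)) (k : ℕ), 0 < (rateCarriersOfRecord₁₃CoPH 𝔯 F θ hP g₀ os k).u3.ρ ∧
        (rateCarriersOfRecord₁₃CoPH 𝔯 F θ hP g₀ os k).u3.ρ ≤ ρ₁ ∧
        (rateCarriersOfRecord₁₃CoPH 𝔯 F θ hP g₀ os k).u3.cr * (rateCarriersOfRecord₁₃CoPH 𝔯 F θ hP g₀ os k).u3.C₉ *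
          (rateCarriersOfRecord₁₃CoPH 𝔯 F θ hP g₀ os k).u3.ω ≤ M :=
  hunif_of_u3Pinned_of_rho 𝔯 G ℓ hpin fun F θ hP hG hθ => rho_row_of_signs (hs F θ hP hG hθ)

/-- **CONVERSELY THE CLAUSE FORCES THE ROW** [bookkeeping]: under the pin, `hunif` gives `0 < (ℓ F θ).ρ ∧ (ℓ F θ).ρ < 1` at every guarded admissible tuple (read at any one
`(g₀, os, k)`, e.g. `(0, [], 0)`). [folklore] -/
theorem rho_row_of_hunif_of_u3Pinned
    (hunif : ∀ (F : T4Family) (θ : Stage13HParams F N) (hP : θ.Provisos₁₃CoPH F N), G θ → θ.Admissible F N →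
      ∃ M ρ₁ : ℝ, 0 ≤ M ∧ ρ₁ < 1 ∧ ∀ (g₀ : ℕ → ℝ) (os : List (ULoop F)) (k : ℕ), 0 < (rateCarriersOfRecord₁₃CoPH 𝔯 F θ hP g₀ os k).u3.ρ ∧
        (rateCarriersOfRecord₁₃CoPH 𝔯 F θ hP g₀ os k).u3.ρ ≤ ρ₁ ∧
        (rateCarriersOfRecord₁₃CoPH 𝔯 F θ hP g₀ os k).u3.cr * (rateCarriersOfRecord₁₃CoPH 𝔯 F θ hP g₀ os k).u3.C₉ *
          (rateCarriersOfRecord₁₃CoPH 𝔯 F θ hP g₀ os k).u3.ω ≤ M) :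
    ∀ (F : T4Family) (θ : Stage13HParams F N), θ.Provisos₁₃CoPH F N → G θ → θ.Admissible F N → 0 < (ℓ F θ).ρ ∧ (ℓ F θ).ρ < 1 := by
  intro F θ hP hG hθ
  obtain ⟨_, ρ₁, _, hρ₁, h⟩ := hunif F θ hP hG hθ
  have h0 := h (fun _ => 0) [] 0
  rw [u3_rateCarriersOfRecord₁₃CoPH_of_pin 𝔯 θ hP (fun _ => 0) [] (ℓ F θ) (hpin F θ hP _ _) 0] at h0
  exact ⟨h0.1, lt_of_le_of_lt h0.2.1 hρ₁⟩

/-- ★ **UNDER THE (t-U3) PIN: `hunif` ⟺ THE LETTER ROW `0 < ρ < 1`** [bookkeeping]. [folklore] -/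
theorem hunif_iff_rho_row_of_u3Pinned :
    (∀ (F : T4Family) (θ : Stage13HParams F N) (hP : θ.Provisos₁₃CoPH F N), G θ → θ.Admissible F N →
      ∃ M ρ₁ : ℝ, 0 ≤ M ∧ ρ₁ < 1 ∧ ∀ (g₀ : ℕ → ℝ) (os : List (ULoop F)) (k : ℕ), 0 < (rateCarriersOfRecord₁₃CoPH 𝔯 F θ hP g₀ os k).u3.ρ ∧
        (rateCarriersOfRecord₁₃CoPH 𝔯 F θ hP g₀ os k).u3.ρ ≤ ρ₁ ∧
        (rateCarriersOfRecord₁₃CoPH 𝔯 F θ hP g₀ os k).u3.cr * (rateCarriersOfRecord₁₃CoPH 𝔯 F θ hP g₀ os k).u3.C₉ *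
          (rateCarriersOfRecord₁₃CoPH 𝔯 F θ hP g₀ os k).u3.ω ≤ M) ↔
      (∀ (F : T4Family) (θ : Stage13HParams F N), θ.Provisos₁₃CoPH F N → G θ → θ.Admissible F N → 0 < (ℓ F θ).ρ ∧ (ℓ F θ).ρ < 1) :=
  ⟨rho_row_of_hunif_of_u3Pinned 𝔯 G ℓ hpin, hunif_of_u3Pinned_of_rho 𝔯 G ℓ hpin⟩

end Pinned

end Summit.QuantumFields.YangMills.BalabanUVNodes.N19UniformLettersAtU3Pin

end
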